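import Summits.AnomalousDissipation.AnomalousDissipation.Theorems.DenseLoudDesignerForces.Negative.KillShape

/-!
# Negative knowledge for the crux `DenseLoudDesignerForces` (stmt-AnomalousDissipation-1143), II: power budget

Certified copy of §3–§4 of the cdisprove work file: for every `τ`-periodic classical Navier–Stokes solution on
`ℝ × T³` with a steady smooth force `F`, mean dissipation = mean injected power and
`meanDissipation² ≤ (∫‖F‖²)·meanEnergy` (energy equality over a period, AM–GM in space-time); on coefficients
`∫‖f_c‖² ≤ ∑‖c k‖²`, so `LOUD_j(S,E,ε) ⊆ {ε² ≤ #S‖c‖²E}` (closed): `0 ∉ closure LOUD_j`, no window contains the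
rest state, `P_S` is never a window, and `LOUD = ∅` over a degenerate stock `S ⊆ {0}` (refuted strengthenings
AtRest / Everywhere / SameStock).  Supports stmt-AnomalousDissipation-1143.
-/

noncomputable section

namespace Summit.AnomalousDissipation.AnomalousDissipation.Theorems.DenseLoudDesignerForces.Negative

open scoped BigOperators Topology ENNReal InnerProductSpace
open Filter Set MeasureTheory UnitAddTorus
open Literature.Analysis.FunctionSpaces Literature.Analysis.FluidPDE
open Summit.AnomalousDissipation.AnomalousDissipation.Theses.BaireTransfer

/-! ## §3 The power budget of a periodic classical orbit

For a `τ`-periodic classical solution forced by a steady smooth field `F`, the period-mean dissipation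
equals the period-mean power input, `⟨ν‖∇u‖²⟩ = ⟨∫⟪F,u⟫⟩` (energy equality over one period), whence by
Cauchy–Schwarz/AM–GM `⟨ν‖∇u‖²⟩² ≤ (∫‖F‖²)·⟨‖u‖²⟩`: LOUDNESS COSTS FORCE × √ENERGY. -/

section PowerBudget

variable {ν τ : ℝ} {F : (UnitAddTorus (Fin 3)) → (EuclideanSpace ℝ (Fin 3))} {u : ℝ → (UnitAddTorus (Fin 3)) → (EuclideanSpace ℝ (Fin 3))} {p : ℝ → (UnitAddTorus (Fin 3)) → ℝ}

/-- Energy equality over one period: `ν ∫₀^τ ‖∇u‖₂² = ∫₀^τ ∫ ⟪F, u⟫` for a `τ`-periodic classical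
solution with steady force. -/
theorem period_dissipation_eq_power (h : Torus.IsClassicalNSSolutionOn univ ν (fun _ => F) u p)
    (hper : Function.Periodic u τ) (hτ : 0 < τ) :
    ν * ∫ t in (0 : ℝ)..τ, Torus.gradNormSq (u t) = ∫ t in (0 : ℝ)..τ, ∫ x, ⟪F x, u t x⟫_ℝ := by
  have hE := h.energy_eq convex_univ hτ.le (subset_univ _)
  have h0 : u τ = u 0 := by simpa using hper 0
  rw [h0] at hE
  linarith

/-- The mean dissipation of a periodic classical orbit is the period mean of `ν‖∇u‖₂²` with POINTWISE
gradients (the spectral `eGradNormSq` agrees with `gradNormSq` on smooth slices). -/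
theorem meanDissipation_eq_period_mean (hu : Torus.IsSmoothSpaceTimeOn univ u)
    (hper : Function.Periodic u τ) (hτ : 0 < τ) :
    meanDissipation ν u = τ⁻¹ * (ν * ∫ t in (0 : ℝ)..τ, Torus.gradNormSq (u t)) := by
  rw [meanDissipation_eq_of_periodic hper hτ]
  congr 1
  rw [← intervalIntegral.integral_const_mul]
  refine intervalIntegral.integral_congr fun t _ => ?_
  rw [Torus.gradNormSq_eq_toReal_eGradNormSq_holds (hu.isSmooth_slice (mem_univ t))]

/-- POWER IDENTITY: mean dissipation = mean power input, `⟨ν‖∇u‖²⟩ = τ⁻¹ ∫₀^τ ∫ ⟪F, u(t)⟫`. -/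
theorem meanDissipation_eq_meanPower (h : Torus.IsClassicalNSSolutionOn univ ν (fun _ => F) u p)
    (hper : Function.Periodic u τ) (hτ : 0 < τ) :
    meanDissipation ν u = τ⁻¹ * ∫ t in (0 : ℝ)..τ, ∫ x, ⟪F x, u t x⟫_ℝ := by
  rw [meanDissipation_eq_period_mean h.smooth_velocity hper hτ, period_dissipation_eq_power h hper hτ]

/-- The mean energy of a periodic orbit is the period mean of `‖u(t)‖₂²`. -/
theorem meanEnergy_eq_period_mean (hper : Function.Periodic u τ) (hτ : 0 < τ) :
    meanEnergy u = τ⁻¹ * ∫ t in (0 : ℝ)..τ, ∫ x, ‖u t x‖ ^ 2 :=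
  meanEnergy_eq_of_periodic hper hτ

/-- The mean energy of a periodic orbit is nonnegative (honest period mean). -/
theorem meanEnergy_nonneg' (hper : Function.Periodic u τ) (hτ : 0 < τ) : 0 ≤ meanEnergy u := by
  rw [meanEnergy_eq_period_mean hper hτ]
  refine mul_nonneg (inv_nonneg.2 hτ.le) ?_
  exact intervalIntegral.integral_nonneg hτ.le fun t _ => integral_nonneg fun _ => sq_nonneg _

/-- Elementary: `2ab ≤ λa² + b²/λ` for `λ > 0`. -/
theorem two_mul_le_weighted {a b lam : ℝ} (hl : 0 < lam) : 2 * (a * b) ≤ lam * a ^ 2 + b ^ 2 / lam := by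
  rw [← sub_nonneg]
  have : lam * a ^ 2 + b ^ 2 / lam - 2 * (a * b) = (lam * a - b) ^ 2 / lam := by
    field_simp
    ring
  rw [this]
  positivity

/-- Elementary optimisation: if `0 ≤ D` and `2D ≤ λA + B/λ` for all `λ > 0` (`A, B ≥ 0`) then `D² ≤ A·B`. -/
theorem sq_le_mul_of_forall_weighted {A B D : ℝ} (hA : 0 ≤ A) (hB : 0 ≤ B) (hD : 0 ≤ D)
    (h : ∀ lam : ℝ, 0 < lam → 2 * D ≤ lam * A + B / lam) : D ^ 2 ≤ A * B := by
  rcases hD.eq_or_lt with hD0 | hDpos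
  · rw [← hD0]; simpa using mul_nonneg hA hB
  rcases hA.eq_or_lt with hA0 | hApos
  · -- `A = 0`: `2D ≤ B/λ` for all `λ`, so `D = 0`, contradiction with `D > 0` unless handled
    exfalso
    have h1 := h ((B + 1) / D) (by positivity)
    rw [← hA0, mul_zero, zero_add, div_div_eq_mul_div] at h1
    have h2 : B * D / (B + 1) < D := by
      rw [div_lt_iff₀ (by positivity)]; nlinarith
    linarith
  rcases hB.eq_or_lt with hB0 | hBpos
  · exfalso
    have h1 := h (D / (A + 1)) (by positivity)
    rw [← hB0, zero_div, add_zero] at h1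
    have h2 : D / (A + 1) * A < D := by
      rw [div_mul_eq_mul_div, div_lt_iff₀ (by positivity)]; nlinarith
    linarith
  -- `A, B > 0`: take `λ = √(B/A)`… squared form: `λ = D / A` gives `2D ≤ D + AB/D`.
  have h1' : 2 * D ≤ D / A * A + B / (D / A) := h (D / A) (by positivity)
  rw [div_mul_cancel₀ _ hApos.ne', div_div_eq_mul_div] at h1'
  have h3 : D ≤ B * A / D := by linarith
  rw [le_div_iff₀ hDpos] at h3
  nlinarith

/-- POWER BUDGET CORE (structure-free): if `u` is jointly smooth and `τ`-periodic, `F` smooth, and a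
number `0 ≤ D` equals the period-mean power `τ⁻¹∫₀^τ∫⟪F,u⟫`, then `D² ≤ (∫‖F‖²)·⟨‖u‖²⟩` (AM–GM in
space-time).  Used for Navier–Stokes AND for the linear Stokes system of §7. -/
theorem power_budget_core (hu : Torus.IsSmoothSpaceTimeOn univ u) (hF : Torus.IsSmooth F)
    (hper : Function.Periodic u τ) (hτ : 0 < τ) {D : ℝ} (hD : 0 ≤ D)
    (hDeq : D = τ⁻¹ * ∫ t in (0 : ℝ)..τ, ∫ x, ⟪F x, u t x⟫_ℝ) :
    D ^ 2 ≤ (∫ x, ‖F x‖ ^ 2) * meanEnergy u := by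
  set A : ℝ := ∫ x, ‖F x‖ ^ 2 with hAdef
  have hA : 0 ≤ A := integral_nonneg fun _ => sq_nonneg _
  have he_st : Torus.IsSmoothSpaceTimeOn univ (fun t x => ‖u t x‖ ^ 2) := by
    change ContDiffOn ℝ _ (fun z => ‖Torus.stLift u z‖ ^ 2) _
    exact hu.norm_sq ℝ
  have he_cont : Continuous fun t => ∫ x, ‖u t x‖ ^ 2 :=
    continuousOn_univ.1 (he_st.continuousOn_integral convex_univ)
  have hB : 0 ≤ meanEnergy u := meanEnergy_nonneg' hper hτ
  -- the power field and its continuity in time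
  have hP_st : Torus.IsSmoothSpaceTimeOn univ (fun t x => ⟪F x, u t x⟫_ℝ) :=
    (Torus.isSmoothSpaceTimeOn_const hF univ).inner hu
  have hP_cont : Continuous fun t => ∫ x, ⟪F x, u t x⟫_ℝ :=
    continuousOn_univ.1 (hP_st.continuousOn_integral convex_univ)
  refine sq_le_mul_of_forall_weighted hA hB hD fun lam hl => ?_
  -- pointwise AM–GM, integrated in space
  have hspace : ∀ t, 2 * ∫ x, ⟪F x, u t x⟫_ℝ ≤ lam * A + (∫ x, ‖u t x‖ ^ 2) / lam := by
    intro t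
    have hut : Torus.IsSmooth (u t) := hu.isSmooth_slice (mem_univ t)
    have hint1 : Integrable (fun x => ⟪F x, u t x⟫_ℝ) := (hF.inner hut).integrable
    have hint2 : Integrable (fun x => lam * ‖F x‖ ^ 2 + ‖u t x‖ ^ 2 / lam) :=
      ((hF.norm_sq.integrable).const_mul lam).add (hut.norm_sq.integrable.div_const lam)
    have hpt : ∀ x, 2 * ⟪F x, u t x⟫_ℝ ≤ lam * ‖F x‖ ^ 2 + ‖u t x‖ ^ 2 / lam := fun x =>
      (mul_le_mul_of_nonneg_left (real_inner_le_norm _ _) zero_le_two).trans (two_mul_le_weighted hl)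
    calc 2 * ∫ x, ⟪F x, u t x⟫_ℝ = ∫ x, 2 * ⟪F x, u t x⟫_ℝ := (integral_const_mul _ _).symm
      _ ≤ ∫ x, (lam * ‖F x‖ ^ 2 + ‖u t x‖ ^ 2 / lam) :=
          integral_mono (hint1.const_mul 2) hint2 hpt
      _ = lam * A + (∫ x, ‖u t x‖ ^ 2) / lam := by
          rw [integral_add ((hF.norm_sq.integrable).const_mul lam) (hut.norm_sq.integrable.div_const lam),
            integral_const_mul, integral_div]
  -- integrate in time over one period
  have htime : 2 * ∫ t in (0 : ℝ)..τ, ∫ x, ⟪F x, u t x⟫_ℝ ≤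
      τ * (lam * A) + (∫ t in (0 : ℝ)..τ, ∫ x, ‖u t x‖ ^ 2) / lam := by
    have hi1 : IntervalIntegrable (fun t => ∫ x, ⟪F x, u t x⟫_ℝ) volume 0 τ :=
      hP_cont.intervalIntegrable _ _
    have hi2 : IntervalIntegrable (fun t => lam * A + (∫ x, ‖u t x‖ ^ 2) / lam) volume 0 τ :=
      (continuous_const.add (he_cont.div_const lam)).intervalIntegrable _ _
    calc 2 * ∫ t in (0 : ℝ)..τ, ∫ x, ⟪F x, u t x⟫_ℝ
        = ∫ t in (0 : ℝ)..τ, 2 * ∫ x, ⟪F x, u t x⟫_ℝ := (intervalIntegral.integral_const_mul _ _).symm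
      _ ≤ ∫ t in (0 : ℝ)..τ, (lam * A + (∫ x, ‖u t x‖ ^ 2) / lam) :=
          intervalIntegral.integral_mono_on hτ.le (hi1.const_mul 2) hi2 fun t _ => hspace t
      _ = τ * (lam * A) + (∫ t in (0 : ℝ)..τ, ∫ x, ‖u t x‖ ^ 2) / lam := by
          rw [intervalIntegral.integral_add intervalIntegrable_const (he_cont.intervalIntegrable _ _ |>.div_const lam),
            intervalIntegral.integral_const, intervalIntegral.integral_div]
          simp
  rw [hDeq, meanEnergy_eq_period_mean hper hτ]
  have hτinv : 0 < τ⁻¹ := inv_pos.2 hτ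
  calc 2 * (τ⁻¹ * ∫ t in (0 : ℝ)..τ, ∫ x, ⟪F x, u t x⟫_ℝ)
      = τ⁻¹ * (2 * ∫ t in (0 : ℝ)..τ, ∫ x, ⟪F x, u t x⟫_ℝ) := by ring
    _ ≤ τ⁻¹ * (τ * (lam * A) + (∫ t in (0 : ℝ)..τ, ∫ x, ‖u t x‖ ^ 2) / lam) :=
        mul_le_mul_of_nonneg_left htime hτinv.le
    _ = lam * A + (τ⁻¹ * ∫ t in (0 : ℝ)..τ, ∫ x, ‖u t x‖ ^ 2) / lam := by
        field_simp

/-- POWER BUDGET (abstract form).  For a `τ`-periodic classical solution with steady smooth force `F`: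
`⟨ν‖∇u‖²⟩² ≤ (∫‖F‖²) · ⟨‖u‖²⟩`, i.e. `meanDissipation² ≤ ‖F‖²_{L²} · meanEnergy`. -/
theorem meanDissipation_sq_le (h : Torus.IsClassicalNSSolutionOn univ ν (fun _ => F) u p)
    (hF : Torus.IsSmooth F) (hν : 0 ≤ ν) (hper : Function.Periodic u τ) (hτ : 0 < τ) :
    meanDissipation ν u ^ 2 ≤ (∫ x, ‖F x‖ ^ 2) * meanEnergy u := by
  have hD : 0 ≤ meanDissipation ν u := by
    rw [meanDissipation_eq_period_mean h.smooth_velocity hper hτ]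
    refine mul_nonneg (inv_nonneg.2 hτ.le) (mul_nonneg hν ?_)
    exact intervalIntegral.integral_nonneg hτ.le fun t _ => Torus.gradNormSq_nonneg _
  exact power_budget_core h.smooth_velocity hF hper hτ hD (meanDissipation_eq_meanPower h hper hτ)

/-- The mean dissipation of a periodic classical orbit is nonnegative (honest period mean). -/
theorem meanDissipation_nonneg (h : Torus.IsClassicalNSSolutionOn univ ν (fun _ => F) u p)
    (hν : 0 ≤ ν) (hper : Function.Periodic u τ) (hτ : 0 < τ) : 0 ≤ meanDissipation ν u := by
  rw [meanDissipation_eq_period_mean h.smooth_velocity hper hτ]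
  refine mul_nonneg (inv_nonneg.2 hτ.le) (mul_nonneg hν ?_)
  exact intervalIntegral.integral_nonneg hτ.le fun t _ => Torus.gradNormSq_nonneg _

end PowerBudget

/-! ## §4 Coefficient bookkeeping and the level shells of the loud sets

`∫‖f_c‖² ≤ ∑_{k∈S} ‖c k‖²` (real part and Leray multiplier are contractions, Parseval), so the power
budget reads on coefficients: `c ∈ LOUD_j(S,E,ε) ⇒ ε² ≤ (∫‖f_c‖²)·E ≤ ‖c‖₂²·E`.  Consequences: the loud
sets avoid a fixed ball around `0`, the rest state `c = 0` is never in the closure of a loud set, a window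
forces `E > 0`, and `LOUD = ∅` when `S ⊆ {0}` (the force vanishes). -/

section Shell

/-- The Leray multiplier is a contraction on coefficients: `‖P_k c‖ ≤ ‖c‖`. -/
theorem norm_lerayCoeff_le (k : Fin 3 → ℤ) (c : (EuclideanSpace ℂ (Fin 3))) : ‖Torus.lerayCoeff k c‖ ≤ ‖c‖ := by
  by_cases hk : k = 0
  · subst hk; simp
  · rw [Torus.lerayCoeff_of_ne_zero hk]; exact Torus.norm_leraySym_le k c

/-- The coordinatewise real part is a contraction: `‖Re w‖ ≤ ‖w‖`. -/
theorem norm_realPart_le (w : (EuclideanSpace ℂ (Fin 3))) : ‖EuclideanSpace.realPart w‖ ≤ ‖w‖ := by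
  rw [EuclideanSpace.norm_eq, EuclideanSpace.norm_eq]
  gcongr with i
  simp only [EuclideanSpace.realPart_apply, Real.norm_eq_abs]
  exact Complex.abs_re_le_norm (w i)

/-- The squared `ℓ²` norm `‖c‖₂² = ∑_{k∈S} ‖c k‖²` of a coefficient vector. -/
def coeffNormSq {S : Finset (Fin 3 → ℤ)} (c : ↥S → (EuclideanSpace ℂ (Fin 3))) : ℝ := ∑ k : ↥S, ‖c k‖ ^ 2

/-- `0 ≤ ‖c‖₂²`. -/
theorem coeffNormSq_nonneg {S : Finset (Fin 3 → ℤ)} (c : ↥S → (EuclideanSpace ℂ (Fin 3))) : 0 ≤ coeffNormSq c :=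
  Finset.sum_nonneg fun _ _ => sq_nonneg _

/-- `‖c‖₂² ≤ #S · ‖c‖²_∞` (sup norm of the product space). -/
theorem coeffNormSq_le_card_mul {S : Finset (Fin 3 → ℤ)} (c : ↥S → (EuclideanSpace ℂ (Fin 3))) :
    coeffNormSq c ≤ S.card * ‖c‖ ^ 2 := by
  unfold coeffNormSq
  calc ∑ k : ↥S, ‖c k‖ ^ 2 ≤ ∑ _k : ↥S, ‖c‖ ^ 2 :=
        Finset.sum_le_sum fun k _ => by gcongr; exact norm_le_pi_norm c k
    _ = S.card * ‖c‖ ^ 2 := by simp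

/-- FORCE SIZE ON COEFFICIENTS: `∫‖f_c‖² ≤ ∑_{k∈S} ‖c k‖²`. -/
theorem integral_norm_sq_force_le (S : Finset (Fin 3 → ℤ)) (c : ↥S → (EuclideanSpace ℂ (Fin 3))) :
    ∫ x, ‖force S c x‖ ^ 2 ≤ coeffNormSq c := by
  set g : (Fin 3 → ℤ) → (EuclideanSpace ℂ (Fin 3)) := fun k => Torus.lerayCoeff k (Torus.coeffExt S c k) with hg
  have h1 : ∫ x, ‖force S c x‖ ^ 2 ≤ ∫ x, ‖Torus.trigPoly S g x‖ ^ 2 := by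
    refine integral_mono ?_ ?_ fun x => ?_
    · exact ((Torus.continuous_realTrigPoly S g).norm.pow 2).integrable_unitAddTorus
    · exact ((Torus.continuous_trigPoly S g).norm.pow 2).integrable_unitAddTorus
    · dsimp only
      unfold force
      rw [Torus.realTrigPoly_apply]
      gcongr
      exact norm_realPart_le _
  have h2 : ∫ x, ‖Torus.trigPoly S g x‖ ^ 2 = ∑ k ∈ S, ‖g k‖ ^ 2 := Torus.integral_norm_sq_trigPoly S g
  have h3 : ∑ k ∈ S, ‖g k‖ ^ 2 ≤ ∑ k ∈ S, ‖Torus.coeffExt S c k‖ ^ 2 :=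
    Finset.sum_le_sum fun k _ => by gcongr; exact norm_lerayCoeff_le k _
  have h4 : ∑ k ∈ S, ‖Torus.coeffExt S c k‖ ^ 2 = coeffNormSq c := by
    unfold coeffNormSq
    rw [← Finset.sum_coe_sort]
    refine Finset.sum_congr rfl fun k _ => ?_
    rw [Torus.coeffExt_coe]
  linarith

/-- The designer force is smooth. -/
theorem isSmooth_force (S : Finset (Fin 3 → ℤ)) (c : ↥S → (EuclideanSpace ℂ (Fin 3))) : Torus.IsSmooth (force S c) :=
  Torus.isSmooth_realTrigPoly S _

/-- LEVEL SHELL (force form): `c ∈ LOUD_j(S,E,ε)`, `0 ≤ ε` ⇒ `ε² ≤ (∫‖f_c‖²)·E`. -/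
theorem sq_le_integral_force_mul_of_mem_loudSet {S : Finset (Fin 3 → ℤ)} {E ε : ℝ} (hε : 0 ≤ ε) {j : ℕ}
    {c : ↥S → (EuclideanSpace ℂ (Fin 3))} (hc : c ∈ loudSet S E ε j) : ε ^ 2 ≤ (∫ x, ‖force S c x‖ ^ 2) * E := by
  obtain ⟨ν, hν, -, τ, u, p, hτ, hsol, hper, hEu, hεu⟩ := hc
  have hA : 0 ≤ ∫ x, ‖force S c x‖ ^ 2 := integral_nonneg fun _ => sq_nonneg _
  calc ε ^ 2 ≤ meanDissipation ν u ^ 2 := by gcongr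
    _ ≤ (∫ x, ‖force S c x‖ ^ 2) * meanEnergy u :=
        meanDissipation_sq_le hsol (isSmooth_force S c) hν.le hper hτ
    _ ≤ (∫ x, ‖force S c x‖ ^ 2) * E := mul_le_mul_of_nonneg_left hEu hA

/-- LEVEL SHELL (coefficient form): `c ∈ LOUD_j(S,E,ε)`, `0 ≤ ε`, `0 ≤ E` ⇒ `ε² ≤ ‖c‖₂²·E`. -/
theorem sq_le_coeffNormSq_mul_of_mem_loudSet {S : Finset (Fin 3 → ℤ)} {E ε : ℝ} (hε : 0 ≤ ε) (hE : 0 ≤ E)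
    {j : ℕ} {c : ↥S → (EuclideanSpace ℂ (Fin 3))} (hc : c ∈ loudSet S E ε j) : ε ^ 2 ≤ coeffNormSq c * E :=
  (sq_le_integral_force_mul_of_mem_loudSet hε hc).trans
    (mul_le_mul_of_nonneg_right (integral_norm_sq_force_le S c) hE)

/-- A loud coefficient vector forces a NONNEGATIVE energy budget (mean energies are honest period means). -/
theorem energy_nonneg_of_mem_loudSet {S : Finset (Fin 3 → ℤ)} {E ε : ℝ} {j : ℕ} {c : ↥S → (EuclideanSpace ℂ (Fin 3))}
    (hc : c ∈ loudSet S E ε j) : 0 ≤ E := by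
  obtain ⟨ν, -, -, τ, u, p, hτ, -, hper, hEu, -⟩ := hc
  exact (meanEnergy_nonneg' hper hτ).trans hEu

/-- QUIET BALL: with `ε > 0`, every `c` with `#S·‖c‖²·E < ε²` is quiet at every level. -/
theorem not_mem_loudSet_of_lt {S : Finset (Fin 3 → ℤ)} {E ε : ℝ} (hε : 0 < ε) {j : ℕ} {c : ↥S → (EuclideanSpace ℂ (Fin 3))}
    (hc : S.card * ‖c‖ ^ 2 * E < ε ^ 2) : c ∉ loudSet S E ε j := by
  intro hmem
  have hE := energy_nonneg_of_mem_loudSet hmem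
  have h1 := sq_le_coeffNormSq_mul_of_mem_loudSet hε.le hE hmem
  have h2 : coeffNormSq c * E ≤ S.card * ‖c‖ ^ 2 * E :=
    mul_le_mul_of_nonneg_right (coeffNormSq_le_card_mul c) hE
  linarith

/-- The loud sets lie in the CLOSED level shell `{c | ε² ≤ #S·‖c‖²·E}` (for `ε > 0`). -/
theorem loudSet_subset_shell (S : Finset (Fin 3 → ℤ)) {E ε : ℝ} (hε : 0 < ε) (j : ℕ) :
    loudSet S E ε j ⊆ {c : ↥S → (EuclideanSpace ℂ (Fin 3)) | ε ^ 2 ≤ S.card * ‖c‖ ^ 2 * E} := fun c hc => by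
  by_contra h
  exact not_mem_loudSet_of_lt hε (not_le.1 h) hc

/-- The level shell is closed. -/
theorem isClosed_shell (S : Finset (Fin 3 → ℤ)) (E ε : ℝ) :
    IsClosed {c : ↥S → (EuclideanSpace ℂ (Fin 3)) | ε ^ 2 ≤ S.card * ‖c‖ ^ 2 * E} :=
  isClosed_le continuous_const ((continuous_const.mul (continuous_norm.pow 2)).mul continuous_const)

/-- … hence so do their closures. -/
theorem closure_loudSet_subset_shell (S : Finset (Fin 3 → ℤ)) {E ε : ℝ} (hε : 0 < ε) (j : ℕ) :
    closure (loudSet S E ε j) ⊆ {c : ↥S → (EuclideanSpace ℂ (Fin 3)) | ε ^ 2 ≤ S.card * ‖c‖ ^ 2 * E} :=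
  closure_minimal (loudSet_subset_shell S hε j) (isClosed_shell S E ε)

/-- AT REST IS NEVER LOUD: `0 ∉ closure LOUD_j(S,E,ε)` for `ε > 0`. -/
theorem zero_not_mem_closure_loudSet (S : Finset (Fin 3 → ℤ)) {E ε : ℝ} (hε : 0 < ε) (j : ℕ) :
    (0 : ↥S → (EuclideanSpace ℂ (Fin 3))) ∉ closure (loudSet S E ε j) := fun h => by
  have := closure_loudSet_subset_shell S hε j h
  simp only [mem_setOf_eq, norm_zero] at this
  nlinarith

/-- REFUTED STRENGTHENING (AtRest): no window contains the zero force. -/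
theorem zero_not_mem_window {S : Finset (Fin 3 → ℤ)} {E ε : ℝ} (hε : 0 < ε) {U : Set (↥S → (EuclideanSpace ℂ (Fin 3)))}
    (hU : IsWindow S E ε U) : (0 : ↥S → (EuclideanSpace ℂ (Fin 3))) ∉ U := fun h0 =>
  zero_not_mem_closure_loudSet S hε 0 (hU.2.2 0 h0)

/-- A window forces a POSITIVE energy budget and, on it, the shell inequality `ε² ≤ #S·‖c‖²·E`. -/
theorem shell_of_window {S : Finset (Fin 3 → ℤ)} {E ε : ℝ} (hε : 0 < ε) {U : Set (↥S → (EuclideanSpace ℂ (Fin 3)))}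
    (hU : IsWindow S E ε U) {c : ↥S → (EuclideanSpace ℂ (Fin 3))} (hc : c ∈ U) : ε ^ 2 ≤ S.card * ‖c‖ ^ 2 * E :=
  closure_loudSet_subset_shell S hε 0 (hU.2.2 0 hc)

/-- A window forces `E > 0`. -/
theorem energy_pos_of_window {S : Finset (Fin 3 → ℤ)} {E ε : ℝ} (hε : 0 < ε) {U : Set (↥S → (EuclideanSpace ℂ (Fin 3)))}
    (hU : IsWindow S E ε U) : 0 < E := by
  obtain ⟨c, hc⟩ := hU.2.1
  have h := shell_of_window hε hU hc
  by_contra hE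
  push Not at hE
  have : (S.card : ℝ) * ‖c‖ ^ 2 * E ≤ 0 := mul_nonpos_of_nonneg_of_nonpos (by positivity) hE
  nlinarith

/-- REFUTED STRENGTHENING (Everywhere): the loud sets are never dense in ALL of `P_S` — `P_S` itself is not
a window (it contains `0`). -/
theorem not_isWindow_univ (S : Finset (Fin 3 → ℤ)) {E ε : ℝ} (hε : 0 < ε) : ¬ IsWindow S E ε univ :=
  fun h => zero_not_mem_window hε h (mem_univ _)

/-- DEGENERATE STOCK: if `S ⊆ {0}` the designer force vanishes identically … -/
theorem force_eq_zero_of_subset {S : Finset (Fin 3 → ℤ)} (hS : S ⊆ {0}) (c : ↥S → (EuclideanSpace ℂ (Fin 3))) : force S c = 0 := by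
  unfold force
  have : (fun k => Torus.lerayCoeff k (Torus.coeffExt S c k)) = fun k =>
      if k ∈ S then (0 : (EuclideanSpace ℂ (Fin 3))) else Torus.lerayCoeff k (Torus.coeffExt S c k) := by
    funext k
    split_ifs with hk
    · have := Finset.mem_singleton.1 (hS hk); subst this; simp
    · rfl
  rw [Torus.realTrigPoly_congr (c' := fun _ => (0 : (EuclideanSpace ℂ (Fin 3)))) (fun k hk => by
    have := Finset.mem_singleton.1 (hS hk); subst this; simp)]
  exact Torus.realTrigPoly_zero S

/-- … so every loud set is EMPTY (`ε > 0`): an unforced periodic classical orbit dissipates nothing on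
average (power identity with `F = 0`).  REFUTED STRENGTHENING (SameStock): the crux with `S = S₀` fails at
`S₀ = ∅` and `S₀ = {0}`; provers must put a non-zero mode into `S`. -/
theorem loudSet_eq_empty_of_subset {S : Finset (Fin 3 → ℤ)} (hS : S ⊆ {0}) {E ε : ℝ} (hε : 0 < ε) (j : ℕ) :
    loudSet S E ε j = ∅ := by
  ext c
  simp only [mem_empty_iff_false, iff_false]
  intro hc
  have h := sq_le_integral_force_mul_of_mem_loudSet hε.le hc
  rw [force_eq_zero_of_subset hS] at h
  simp only [Pi.zero_apply, norm_zero, ne_eq, OfNat.ofNat_ne_zero, not_false_eq_true, zero_pow,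
    integral_zero, zero_mul] at h
  nlinarith

/-- … hence no window exists over a degenerate stock `S ⊆ {0}`. -/
theorem not_isWindow_of_subset {S : Finset (Fin 3 → ℤ)} (hS : S ⊆ {0}) {E ε : ℝ} (hε : 0 < ε)
    (U : Set (↥S → (EuclideanSpace ℂ (Fin 3)))) : ¬ IsWindow S E ε U := fun h => by
  obtain ⟨c, hc⟩ := h.2.1
  have := h.2.2 0 hc
  rw [loudSet_eq_empty_of_subset hS hε, closure_empty] at this
  exact this

end Shell

end Summit.AnomalousDissipation.AnomalousDissipation.Theorems.DenseLoudDesignerForces.Negative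

end
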